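import Literature.MathematicalPhysics.QuantumFieldTheory.Balaban1983to89.Node00.N24GlueStage5C
import Literature.MathematicalPhysics.QuantumFieldTheory.Balaban1983to89.B16NodeKnitRecord5C

/-!
# NODE N24 · binder B2 — DESIGN E WITH SMALLNESS THRESHOLDS («for γ sufficiently small») over the record predicate of record `IsRecordOfRecord₅C` and its
# refinements, and the knit of N13's `₅C` statement of record (`B16NodeKnitRecord5C`, seat dag-n13-a) into N24 at `₅C`

TRACK A (YM-PLAN §2d, node N24 of 28), seat `pub-ymgap-dag-n24-a` (-a KNIT-BY-NAME).  SEVENTH N24 module, a NEW importing one (append-only growth).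
WHY: the record predicates ₅ ∕ ₅C carry EVERY interval constant `γ > 0` over one datum (`N24_isRecordOfRecord₅C_reletter`;
`B16NodeKnitRecord5C.isRecordOfRecord₅C_withGamma`), while every printed child holds only «for γ sufficiently small» ([Balaban1987RG1] Thm 1 p. 259,
[Balaban1989LargeFieldII] Thm 1 p. 355; [Balaban1988Convergent] Cor. 3 *«Under the assumptions of Theorem 1»*).  Seat dag-n13-a therefore RECOMMENDS the child
text with a THRESHOLD — `s_N13E_threshold_shape_of_slots₅C`: «∀ D, (∃ w, Rec₅C D w) → ∃ γ₁ > 0, ∃ e₋ e₊, ∀ w, Rec₅C D w → w.γ ≤ γ₁ → w.em = e₋ → w.ep = e₊ →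
∀ P, N13» — and notes «a glue in design E re-letters the world to γ := min γ₀ γ₁».  THIS MODULE IS THAT GLUE: N24's design-E face in which EVERY child is
asked only at record worlds whose interval constant lies below a threshold, the glue re-lettering the world to the minimum of the record's `γ`, the
β-window's `γ₀`, the children's threshold `γₛ` and N13's `γ₁` (all positive), where `Record5C.endStatementBPrinted_of_isRecordOfRecord₅C_of_nodes` applies with
`w.γ ≤ γ₀`.  THEOREMS ONLY, def-free, sorry-free, standard axioms; CONVENTIONS OF RECORD of `Node00.Carriers` apply.

* §0 `N24_exists_isRecordOfRecord₅_and₅C` ∕ `N24_exists_isRecordOfRecord₅C` ∕ `N24_exists_isRecordOfRecord₅` — the Stage-5 record predicates are INHABITED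
  on every family (one junk datum: trivial residual, `R = id`; junk by design until stage ₈ ∕ ₉): the `hex` input below and cluster K1's existence half, as
  TREE theorems (referee ref-D [REFD-G5-R436B-CONCUR] (2) asked for exactly this two-line theorem; director-ym LINE №22's inhabitation rider).
* §1 `N24_at_datumE_threshold_of_refines₅C` — over ANY `Rec` refining ₅C and closed under γ-LOWERING re-lettering: a `Rec`-world over `D`; ONE smallness
  threshold `γₛ > 0` below which the nine children N03, N05–N12 hold at every `Rec`-world over `D`; N13 in dag-n13-a's THRESHOLD design-E text (its own
  `γ₁`, exponent functions chosen after the datum); the β-side `∃ γ₀ b β⁺, 0 < γ₀ ∧ 0 < b ∧ BetaBoundsInInterval D.C.toB12 γ₀ b β⁺` ⇒ `B16.EndStatementBPrinted D.C`.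
  `…_of_boxBounds`: window as box bounds on `D.βfun`.  `N24_B2_atRecordE_threshold_of_refines₅C`: cluster level, per-datum thresholds.
  VACUITY NOTE (unchanged from modules 4 ∕ 5): at `Rec := ₅C` ITSELF the nine-children stub is refutable for every `γₛ` (free [B9] residual `Y`:
  `B9LeafUnpinnedRecord5`, transported along `Record5C.isRecordOfRecord₅C_rebind_of_isRecordOfRecord₅`); the face is for the carrier-pinning refinements
  (stage ₉C → ₅C re-proved field by field, chair R437 (1)); at ₅C use the PER-WORLD faces.
* §2 `N24_at_record₅C_knit₁₃` — PER-WORLD, at ₅C, N13 ENTERED BY NAME at its ₅C statement of record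
  (`B16NodeKnitRecord5C.b16_main_reExp_of_isRecordOfRecord₅C e₋ e₊ h hR hcor`) into `N24_at_record₅C_of_N13_exists`; N11 stays a binder at ₅C until dag-n11-a's
  ₅C twin of `B14NodeKnitRecord5.b14_main_of_isRecordOfRecord₅` lands (its `hup` reads the N-binding).  `…_of_prop26`: N03 at its statement of record too.

WHICH CHILD BLOCKS (2026-08-26T00:2xZ): as in `Node00.N24KnitStage5` ∕ `N24GlueStage5C` — THEOREMS N01 N02 N04 N23 hC hγ (0.20); BY NAME MOD SLOTS N03, N11 (₅),
N13 (₅ and ₅C); PURE BINDERS N05 N06 N07 N08 N09 N10 N12 + the β-box bounds (`b > 0` UNPRINTED, T09.F).  Per chair R437 (4)(d) no (B)-face is typed over ₇C ∕ ₈C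
(densities there are `rnDeriv` versions); ₉C re-bases ₅C and these faces apply through its refinement theorem.
HONEST FRAMING: kernel bookkeeping BY NAME; every slot ∕ threshold is a HYPOTHESIS, nothing of Bałaban's asserted; N24 COMPOSITE — no discharge, no count;
finite T⁴ at fixed ε; NOT ℝ⁴ ∕ OS ∕ mass gap ∕ Clay.
-/

noncomputable section

namespace Literature.MathematicalPhysics.QuantumFieldTheory.Balaban1983to89.Node00

open DagBinding T4Continuum T4DatumAssembly FlowStepRuns AveragingRT

/-! ## §0. The Stage-5 record predicates are INHABITED on every family (the `hex` ∕ K1-existence input, in the tree) -/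

section Inhabited

variable (F : T4Family) (N : ℕ) [NeZero N]

/-- **NODE 00's Stage-5 record predicates are inhabited on every four-torus family, at every `N`** — both the N-binding twin `IsRecordOfRecord₅` and THE
PREDICATE OF RECORD `IsRecordOfRecord₅C`, over ONE datum: admissible Stage-3 parameters with `D = 4` (`N24_exists_stage3Params`), `γ := 1`, and a residual
whose objects are the TRIVIAL ones (constant carrier families from the inhabited carrier types, `β ≡ 0`, `E ≡ 0`, empty domains, zero actions ∕ χ, format
predicates `False`, `R = id` with (0.4) by `rfl`); the worlds are any binding context re-bound to the assembled construction, `γ`, `L` and the binding of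
record (`Record5.isRecordOfRecord₅_of_eq` ∕ `Record5C.isRecordOfRecord₅C_of_eq`).  This is the `∃ w, Rec D w` input of the design-E faces and the existence
half of cluster K1 at ₅ ∕ ₅C — a JUNK inhabitant by design (node00-def: the record is junk-inhabited until stage ₈ ∕ ₉); it says nothing about Bałaban's
objects (director-ym LINE №22's inhabitation rider: the kernel witness a Stage-5 booking cites). [cite: Balaban1989LargeFieldII, Thm 1 p.355 (objects of record; bookkeeping witness, no estimate)] -/
theorem N24_exists_isRecordOfRecord₅_and₅C :
    ∃ (D : FiniteEpsData F (SU N)) (w w' : WorldP), IsRecordOfRecord₅ F N D w ∧ IsRecordOfRecord₅C F N D w' := by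
  obtain ⟨θ₃, hθ₃, -⟩ := N24_exists_stage3Params
  obtain ⟨X⟩ := nonempty_printedCarriersR
  obtain ⟨Y⟩ := nonempty_printedCarriers9X
  obtain ⟨Z⟩ := nonempty_printedCarriers11
  obtain ⟨V⟩ := nonempty_printedCarriers14R
  obtain ⟨W⟩ := nonempty_printedCarriers15
  obtain ⟨w₀⟩ := nonempty_worldP
  let res : Residual₅ F N :=
    { X := fun _ => X, Y := fun _ => Y, Z := fun _ => Z, V := fun _ => V, W := fun _ => W, βfun := fun _ _ => 0, E := fun _ => 0,
      dom := fun _ _ => ∅, effAction := fun _ _ _ => 0, wilsonBG := fun _ _ _ => 0, Ek := fun _ _ _ => 0, χ := fun _ _ _ => 0,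
      S218 := fun _ _ _ => False, ReprA := fun _ _ _ _ _ _ _ => False, IndA := fun _ _ _ _ _ _ _ => False, R := fun _ _ => id,
      preservesIntegral_R := fun _ _ _ _ => rfl, integrable_R := fun _ _ _ _ h => h }
  let θ : Stage5Params F N := { θ₃ with γ := 1, res := res }
  have hθ : θ.Admissible := ⟨hθ₃, one_pos⟩
  let w : WorldP :=
    { w₀ with
      C := (datumOfRecord₅ F N θ).C, γ := θ.γ, L := (θ.L : ℝ), one_lt_L := by exact_mod_cast θ₃.hL.2
      up := fun P => upOfRecord₅ F N θ P }
  let w' : WorldP :=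
    { w₀ with
      C := (datumOfRecord₅ F N θ).C, γ := θ.γ, L := (θ.L : ℝ), one_lt_L := by exact_mod_cast θ₃.hL.2
      up := fun P => upOfRecord₅C F N θ P }
  exact ⟨datumOfRecord₅ F N θ, w, w', isRecordOfRecord₅_of_eq F N θ hθ w rfl rfl rfl (fun _ => rfl),
    isRecordOfRecord₅C_of_eq F N θ hθ w' rfl rfl rfl (fun _ => rfl)⟩

/-- **`∃ D w, IsRecordOfRecord₅C F N D w`** — the predicate of record is inhabited on every family (the two-line tree theorem referee ref-D asked for,
[REFD-G5-R436B-CONCUR] (2); junk inhabitant, count-neutral). [cite: Balaban1989LargeFieldII, Thm 1 p.355 (bookkeeping witness, no estimate)] -/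
theorem N24_exists_isRecordOfRecord₅C : ∃ (D : FiniteEpsData F (SU N)) (w : WorldP), IsRecordOfRecord₅C F N D w := by
  obtain ⟨D, -, w', -, h⟩ := N24_exists_isRecordOfRecord₅_and₅C F N
  exact ⟨D, w', h⟩

/-- `∃ D w, IsRecordOfRecord₅ F N D w` — the N-binding twin is inhabited too (same datum). [cite: Balaban1989LargeFieldII, Thm 1 p.355 (bookkeeping witness, no estimate)] -/
theorem N24_exists_isRecordOfRecord₅ : ∃ (D : FiniteEpsData F (SU N)) (w : WorldP), IsRecordOfRecord₅ F N D w := by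
  obtain ⟨D, w, -, h, -⟩ := N24_exists_isRecordOfRecord₅_and₅C F N
  exact ⟨D, w, h⟩

end Inhabited

variable {F : T4Family} {N : ℕ} [NeZero N]

/-! ## §1. Design E with smallness thresholds over a record predicate refining `₅C` -/

section Threshold

variable {Rec : FiniteEpsData F (SU N) → WorldP → Prop}

/-- **N24ᴱ WITH THRESHOLDS · (B2) FOR A DATUM over ANY record predicate `Rec` refining `₅C` and closed under γ-LOWERING re-lettering.**  Hypotheses: a
`Rec`-world over `D`; ONE smallness threshold `γₛ > 0` such that the nine children N03, N05–N12 hold at every run of every `Rec`-world over `D` WITH `w.γ ≤ γₛ`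
(«for γ sufficiently small», the printed reading); N13 in the THRESHOLD design-E text dag-n13-a recommends (`∃ γ₁ > 0, ∃ e₋ e₊, ∀ w, Rec D w → w.γ ≤ γ₁ → w.em =
e₋ → w.ep = e₊ → ∀ P, Dag.B16_main (leavesP w P)`, the conclusion of `B16NodeKnitRecord5C.s_N13E_threshold_shape_of_slots₅C` at one datum); the β-side `∃ γ₀ b β⁺,
0 < γ₀ ∧ 0 < b ∧ BetaBoundsInInterval D.C.toB12 γ₀ b β⁺` ([Balaban1987RG1] (1.22); `RenormalisationBetaE` shape).  Conclusion `B16.EndStatementBPrinted D.C`.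
Proof: re-letter the world to `γ' := min (min w.γ γ₀) (min γₛ γ₁)` (positive, `≤` each of the four) with the β-letters and exponent witnesses; the re-lettered
world is a `Rec`-world (`hRL`), hence a `₅C` record (`hRec`); collect the thirteen nodes there (N01 ∕ N02 ∕ N04 from `Record5C`) and apply
`Record5C.endStatementBPrinted_of_isRecordOfRecord₅C_of_nodes` with `γ' ≤ γ₀`.  No world letter is read by any hypothesis. [cite: Balaban1989LargeFieldII, Thm 1 p.355 + p.391; Balaban1988Convergent, Cor. 3 (2.50) p.264; Balaban1987RG1, Thm 1 p.259 and (1.22) p.264 (bookkeeping; thresholds and letters existential as in print)] -/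
theorem N24_at_datumE_threshold_of_refines₅C
    (hRec : ∀ {D : FiniteEpsData F (SU N)} {w : WorldP}, Rec D w → IsRecordOfRecord₅C F N D w)
    (hRL : ∀ {D : FiniteEpsData F (SU N)} {w : WorldP} {γ' b' : ℝ} (hγ' : 0 < γ') (_ : γ' ≤ w.γ) (hb' : 0 < b') (βup' : ℝ) (em ep : ℝ → ℝ),
      Rec D w → Rec D { w with γ := γ', b := b', b_pos := hb', βup := βup', em := em, ep := ep })
    {D : FiniteEpsData F (SU N)} (hex : ∃ w : WorldP, Rec D w) {γs : ℝ} (hγs : 0 < γs)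
    (h03 : ∀ w : WorldP, Rec D w → w.γ ≤ γs → ∀ P : B12.RunParams, Dag.B6_main (leavesP w P))
    (h05 : ∀ w : WorldP, Rec D w → w.γ ≤ γs → ∀ P : B12.RunParams, Dag.B8_main (leavesP w P))
    (h06 : ∀ w : WorldP, Rec D w → w.γ ≤ γs → ∀ P : B12.RunParams, Dag.B9_main (leavesP w P))
    (h07 : ∀ w : WorldP, Rec D w → w.γ ≤ γs → ∀ P : B12.RunParams, Dag.B11_main (leavesP w P))
    (h08 : ∀ w : WorldP, Rec D w → w.γ ≤ γs → ∀ P : B12.RunParams, Dag.B10_main (leavesP w P))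
    (h09 : ∀ w : WorldP, Rec D w → w.γ ≤ γs → ∀ P : B12.RunParams, Dag.B12_main (leavesP w P))
    (h10 : ∀ w : WorldP, Rec D w → w.γ ≤ γs → ∀ P : B12.RunParams, Dag.B13_main (leavesP w P))
    (h11 : ∀ w : WorldP, Rec D w → w.γ ≤ γs → ∀ P : B12.RunParams, Dag.B14_main (leavesP w P))
    (h12 : ∀ w : WorldP, Rec D w → w.γ ≤ γs → ∀ P : B12.RunParams, Dag.B15_main (leavesP w P))
    (h13 : ∃ γ₁ : ℝ, 0 < γ₁ ∧ ∃ em ep : ℝ → ℝ, ∀ w : WorldP, Rec D w → w.γ ≤ γ₁ → w.em = em → w.ep = ep →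
      ∀ P : B12.RunParams, Dag.B16_main (leavesP w P))
    (hβ : ∃ γ₀ b βup : ℝ, 0 < γ₀ ∧ 0 < b ∧ BetaBoundsInInterval D.C.toB12 γ₀ b βup) :
    B16.EndStatementBPrinted D.C := by
  obtain ⟨w, hw⟩ := hex
  obtain ⟨γ₁, hγ₁, em, ep, h16⟩ := h13
  obtain ⟨γ₀, b, βup, hγ₀, hb, hβ⟩ := hβ
  have hwγ : 0 < w.γ := gamma_pos_of_isRecordOfRecord₅C (hRec hw)
  have hγ' : 0 < min (min w.γ γ₀) (min γs γ₁) := lt_min (lt_min hwγ hγ₀) (lt_min hγs hγ₁)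
  have hle_w : min (min w.γ γ₀) (min γs γ₁) ≤ w.γ := (min_le_left _ _).trans (min_le_left _ _)
  have hle₀ : min (min w.γ γ₀) (min γs γ₁) ≤ γ₀ := (min_le_left _ _).trans (min_le_right _ _)
  have hleₛ : min (min w.γ γ₀) (min γs γ₁) ≤ γs := (min_le_right _ _).trans (min_le_left _ _)
  have hle₁ : min (min w.γ γ₀) (min γs γ₁) ≤ γ₁ := (min_le_right _ _).trans (min_le_right _ _)
  have hw' : Rec D { w with γ := min (min w.γ γ₀) (min γs γ₁), b := b, b_pos := hb, βup := βup, em := em, ep := ep } :=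
    hRL hγ' hle_w hb βup em ep hw
  have h5 : IsRecordOfRecord₅C F N D { w with γ := min (min w.γ γ₀) (min γs γ₁), b := b, b_pos := hb, βup := βup, em := em, ep := ep } :=
    hRec hw'
  refine endStatementBPrinted_of_isRecordOfRecord₅C_of_nodes h5 hle₀
    (N24_nodes_of_children₅C h5 (h03 _ hw' hleₛ) (h05 _ hw' hleₛ) (h06 _ hw' hleₛ) (h07 _ hw' hleₛ) (h08 _ hw' hleₛ) (h09 _ hw' hleₛ)
      (h10 _ hw' hleₛ) (h11 _ hw' hleₛ) (h12 _ hw' hleₛ) (h16 _ hw' hle₁ rfl rfl)) ?_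
  rw [construction_eq_of_isRecordOfRecord₅C h5]
  exact hβ

/-- **Design E with thresholds, window as BOX BOUNDS on `D.βfun`** (`FlowStep.BetaLowerH b γ₀ D.βfun` — UNPRINTED lower bound, T09.F; `FlowStep.BetaUpperH β⁺ γ₀
D.βfun` — [Balaban1987RG1] p. 264): through `D.curries`, then `N24_at_datumE_threshold_of_refines₅C`. [cite: Balaban1989LargeFieldII, Thm 1 p.355 + p.391; Balaban1987RG1, (1.22) p.264 (bookkeeping)] -/
theorem N24_at_datumE_threshold_of_refines₅C_of_boxBounds
    (hRec : ∀ {D : FiniteEpsData F (SU N)} {w : WorldP}, Rec D w → IsRecordOfRecord₅C F N D w)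
    (hRL : ∀ {D : FiniteEpsData F (SU N)} {w : WorldP} {γ' b' : ℝ} (hγ' : 0 < γ') (_ : γ' ≤ w.γ) (hb' : 0 < b') (βup' : ℝ) (em ep : ℝ → ℝ),
      Rec D w → Rec D { w with γ := γ', b := b', b_pos := hb', βup := βup', em := em, ep := ep })
    {D : FiniteEpsData F (SU N)} (hex : ∃ w : WorldP, Rec D w) {γs : ℝ} (hγs : 0 < γs)
    (h03 : ∀ w : WorldP, Rec D w → w.γ ≤ γs → ∀ P : B12.RunParams, Dag.B6_main (leavesP w P))
    (h05 : ∀ w : WorldP, Rec D w → w.γ ≤ γs → ∀ P : B12.RunParams, Dag.B8_main (leavesP w P))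
    (h06 : ∀ w : WorldP, Rec D w → w.γ ≤ γs → ∀ P : B12.RunParams, Dag.B9_main (leavesP w P))
    (h07 : ∀ w : WorldP, Rec D w → w.γ ≤ γs → ∀ P : B12.RunParams, Dag.B11_main (leavesP w P))
    (h08 : ∀ w : WorldP, Rec D w → w.γ ≤ γs → ∀ P : B12.RunParams, Dag.B10_main (leavesP w P))
    (h09 : ∀ w : WorldP, Rec D w → w.γ ≤ γs → ∀ P : B12.RunParams, Dag.B12_main (leavesP w P))
    (h10 : ∀ w : WorldP, Rec D w → w.γ ≤ γs → ∀ P : B12.RunParams, Dag.B13_main (leavesP w P))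
    (h11 : ∀ w : WorldP, Rec D w → w.γ ≤ γs → ∀ P : B12.RunParams, Dag.B14_main (leavesP w P))
    (h12 : ∀ w : WorldP, Rec D w → w.γ ≤ γs → ∀ P : B12.RunParams, Dag.B15_main (leavesP w P))
    (h13 : ∃ γ₁ : ℝ, 0 < γ₁ ∧ ∃ em ep : ℝ → ℝ, ∀ w : WorldP, Rec D w → w.γ ≤ γ₁ → w.em = em → w.ep = ep →
      ∀ P : B12.RunParams, Dag.B16_main (leavesP w P))
    (hβ : ∃ γ₀ b βup : ℝ, 0 < γ₀ ∧ 0 < b ∧ FlowStep.BetaLowerH b γ₀ D.βfun ∧ FlowStep.BetaUpperH βup γ₀ D.βfun) :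
    B16.EndStatementBPrinted D.C := by
  obtain ⟨γ₀, b, βup, hγ₀, hb, hlo, hhi⟩ := hβ
  exact N24_at_datumE_threshold_of_refines₅C hRec hRL hex hγs h03 h05 h06 h07 h08 h09 h10 h11 h12 h13
    ⟨γ₀, b, βup, hγ₀, hb, DagBinding.betaBoundsInInterval_of_boxBounds D.C.toB12 D.βfun D.curries hlo hhi⟩

/-- **N24ᴱ WITH THRESHOLDS AT CLUSTER LEVEL over a `₅C`-refinement** — «∀ D w, Rec D w → B16.EndStatementBPrinted D.C» from the children stated ONCE: the nine
children N03, N05–N12 as ONE per-datum thresholded stub («for every datum with a `Rec`-world there is `γₛ > 0` below which they hold at every `Rec`-world over it»),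
N13 as dag-n13-a's threshold text (verbatim the conclusion of `B16NodeKnitRecord5C.s_N13E_threshold_shape_of_slots₅C`, read with `Rec` for `₅C`), the β-side per
record.  Cluster K1 is a THEOREM below `₅C`.  Same VACUITY NOTE at `Rec := ₅C` itself. [cite: Balaban1989LargeFieldII, Thm 1 p.355 + p.391; Balaban1988Convergent, Cor. 3 (2.50) p.264; Balaban1987RG1, Thm 1 p.259 (bookkeeping)] -/
theorem N24_B2_atRecordE_threshold_of_refines₅C
    (hRec : ∀ {D : FiniteEpsData F (SU N)} {w : WorldP}, Rec D w → IsRecordOfRecord₅C F N D w)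
    (hRL : ∀ {D : FiniteEpsData F (SU N)} {w : WorldP} {γ' b' : ℝ} (hγ' : 0 < γ') (_ : γ' ≤ w.γ) (hb' : 0 < b') (βup' : ℝ) (em ep : ℝ → ℝ),
      Rec D w → Rec D { w with γ := γ', b := b', b_pos := hb', βup := βup', em := em, ep := ep })
    (SK : ∀ D : FiniteEpsData F (SU N), (∃ w : WorldP, Rec D w) → ∃ γs : ℝ, 0 < γs ∧ ∀ w : WorldP, Rec D w → w.γ ≤ γs →
      ∀ P : B12.RunParams, Dag.B6_main (leavesP w P) ∧ Dag.B8_main (leavesP w P) ∧ Dag.B9_main (leavesP w P) ∧ Dag.B11_main (leavesP w P) ∧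
        Dag.B10_main (leavesP w P) ∧ Dag.B12_main (leavesP w P) ∧ Dag.B13_main (leavesP w P) ∧ Dag.B14_main (leavesP w P) ∧
        Dag.B15_main (leavesP w P))
    (S13 : ∀ D : FiniteEpsData F (SU N), (∃ w : WorldP, Rec D w) →
      ∃ γ₁ : ℝ, 0 < γ₁ ∧ ∃ em ep : ℝ → ℝ, ∀ w : WorldP, Rec D w → w.γ ≤ γ₁ → w.em = em → w.ep = ep →
        ∀ P : B12.RunParams, Dag.B16_main (leavesP w P))
    (SβE : ∀ (D : FiniteEpsData F (SU N)) (w : WorldP), Rec D w →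
      ∃ γ₀ b βup : ℝ, 0 < γ₀ ∧ 0 < b ∧ BetaBoundsInInterval D.C.toB12 γ₀ b βup) :
    ∀ (D : FiniteEpsData F (SU N)) (w : WorldP), Rec D w → B16.EndStatementBPrinted D.C := by
  intro D w hw
  obtain ⟨γs, hγs, hK⟩ := SK D ⟨w, hw⟩
  exact N24_at_datumE_threshold_of_refines₅C hRec hRL ⟨w, hw⟩ hγs
    (fun w' h' hγ P => (hK w' h' hγ P).1) (fun w' h' hγ P => (hK w' h' hγ P).2.1) (fun w' h' hγ P => (hK w' h' hγ P).2.2.1)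
    (fun w' h' hγ P => (hK w' h' hγ P).2.2.2.1) (fun w' h' hγ P => (hK w' h' hγ P).2.2.2.2.1)
    (fun w' h' hγ P => (hK w' h' hγ P).2.2.2.2.2.1) (fun w' h' hγ P => (hK w' h' hγ P).2.2.2.2.2.2.1)
    (fun w' h' hγ P => (hK w' h' hγ P).2.2.2.2.2.2.2.1) (fun w' h' hγ P => (hK w' h' hγ P).2.2.2.2.2.2.2.2)
    (S13 D ⟨w, hw⟩) (SβE D w hw)

/-- `₅C` itself satisfies the two structural hypotheses of the faces above: it refines itself, and it is closed under re-lettering (any `γ' > 0`, in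
particular γ-lowering) — `N24_isRecordOfRecord₅C_reletter`.  (Recorded so that a consumer at a refinement `Rec → ₅C` sees exactly which closure property is
left to CHECK for `Rec`; NOT an invitation to instantiate §1 at `₅C`, see the VACUITY NOTE.) [cite: Balaban1989LargeFieldII, Thm 1 p.355 (bookkeeping)] -/
theorem N24_reletterDown₅C {D : FiniteEpsData F (SU N)} {w : WorldP} {γ' b' : ℝ} (hγ' : 0 < γ') (_hle : γ' ≤ w.γ) (hb' : 0 < b')
    (βup' : ℝ) (em ep : ℝ → ℝ) (h : IsRecordOfRecord₅C F N D w) :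
    IsRecordOfRecord₅C F N D { w with γ := γ', b := b', b_pos := hb', βup := βup', em := em, ep := ep } :=
  N24_isRecordOfRecord₅C_reletter h hγ' hb' βup' em ep

end Threshold

/-! ## §2. Per world, at `₅C`: N13 entered BY NAME at its `₅C` statement of record -/

section KnitC

variable {D : FiniteEpsData F (SU N)} {w : WorldP}

/-- **N24 · (B2) at a `₅C` record with N13 KNIT BY NAME** (`B16NodeKnitRecord5C.b16_main_reExp_of_isRecordOfRecord₅C`, seat dag-n13-a: datum-indexed exponent
families `e₋ e₊`, (R₅) = [III] p. 244's property of the residual 𝐑-carrier for the parameters of `D`, `hcor` = one representation family of `(datumOfRecord₅ θ).C`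
with [III] p. 264's five leaves at `(w.γ, e₋ D, e₊ D)`): N03, N05–N12 binders at the record world (N11 too — its knit is at ₅ today), box bounds on `D.βfun` ⇒
`B16.EndStatementBPrinted D.C`, by `N24_at_record₅C_of_N13_exists` with the witness `(e₋ D, e₊ D, b16_main_reExp_of_isRecordOfRecord₅C …)`.
[cite: Balaban1989LargeFieldII, Thm 1 p.355 + pp.387, 391; Balaban1988Convergent, p.244 and Cor. 3 (2.50) p.264; Balaban1987RG1, (1.22) p.264 (bookkeeping over the pinned form)] -/
theorem N24_at_record₅C_knit₁₃ (h : IsRecordOfRecord₅C F N D w) {γ₀ : ℝ} (hγ₀ : w.γ ≤ γ₀)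
    (h03 : ∀ P : B12.RunParams, Dag.B6_main (leavesP w P)) (h05 : ∀ P : B12.RunParams, Dag.B8_main (leavesP w P))
    (h06 : ∀ P : B12.RunParams, Dag.B9_main (leavesP w P)) (h07 : ∀ P : B12.RunParams, Dag.B11_main (leavesP w P))
    (h08 : ∀ P : B12.RunParams, Dag.B10_main (leavesP w P)) (h09 : ∀ P : B12.RunParams, Dag.B12_main (leavesP w P))
    (h10 : ∀ P : B12.RunParams, Dag.B13_main (leavesP w P)) (h11 : ∀ P : B12.RunParams, Dag.B14_main (leavesP w P))
    (h12 : ∀ P : B12.RunParams, Dag.B15_main (leavesP w P))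
    (eM eP : FiniteEpsData F (SU N) → ℝ → ℝ)
    (hR : ∀ θ : Stage5Params F N, θ.Admissible → D = datumOfRecord₅ F N θ → ∀ P : B12.RunParams, ROpLeaf (θ.res.V P))
    (hcor : ∀ θ : Stage5Params F N, θ.Admissible → D = datumOfRecord₅ F N θ →
      ∃ R : B14Cor3.ReprFamily (datumOfRecord₅ F N θ).C,
        B14Cor3.LeafH (datumOfRecord₅ F N θ).C R w.γ ∧ B14Cor3.LeafU1 (datumOfRecord₅ F N θ).C R w.γ ∧
        B14Cor3.LeafU2 (datumOfRecord₅ F N θ).C R w.γ (eP D) ∧ B14Cor3.LeafL1 (datumOfRecord₅ F N θ).C R w.γ ∧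
        B14Cor3.LeafL2 (datumOfRecord₅ F N θ).C R w.γ (eM D))
    (hlo : FlowStep.BetaLowerH w.b γ₀ D.βfun) (hhi : FlowStep.BetaUpperH w.βup γ₀ D.βfun) :
    B16.EndStatementBPrinted D.C :=
  N24_at_record₅C_of_N13_exists h hγ₀ h03 h05 h06 h07 h08 h09 h10 h11 h12
    ⟨eM D, eP D, B16NodeKnitRecord5C.b16_main_reExp_of_isRecordOfRecord₅C eM eP h hR hcor⟩ hlo hhi

/-- The same with N03 at its statement of record (Prop. 2.6 census, `Record5C.b6_main_of_isRecordOfRecord₅C_of_prop26`): eight pure binders N05–N12 remain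
beside N03's census, N13's exponent families + slots and the β-box bounds. [cite: Balaban1989LargeFieldII, Thm 1 p.355 + p.391; Balaban1984PropagatorsII, Prop. 2.6 (2.136)–(2.140) p.247; Balaban1988Convergent, Cor. 3 (2.50) p.264 (bookkeeping)] -/
theorem N24_at_record₅C_knit₁₃_of_prop26 (h : IsRecordOfRecord₅C F N D w) {γ₀ : ℝ} (hγ₀ : w.γ ≤ γ₀)
    (h26 : ∀ θ : Stage3Params, θ.toStage1Params.Admissible →
      B6.Prop26Printed (fun i : B6KLevelCensusIndexV1.KIdx θ.d₆ θ.ℓ₆ θ.hd' θ.hL' θ.b₀ θ.b₁ => B6KLevelCensusIndexV1.kGeoG i)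
        (fun i => B6Prop26Census2136KLevelV1.kG i))
    (h05 : ∀ P : B12.RunParams, Dag.B8_main (leavesP w P))
    (h06 : ∀ P : B12.RunParams, Dag.B9_main (leavesP w P)) (h07 : ∀ P : B12.RunParams, Dag.B11_main (leavesP w P))
    (h08 : ∀ P : B12.RunParams, Dag.B10_main (leavesP w P)) (h09 : ∀ P : B12.RunParams, Dag.B12_main (leavesP w P))
    (h10 : ∀ P : B12.RunParams, Dag.B13_main (leavesP w P)) (h11 : ∀ P : B12.RunParams, Dag.B14_main (leavesP w P))
    (h12 : ∀ P : B12.RunParams, Dag.B15_main (leavesP w P))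
    (eM eP : FiniteEpsData F (SU N) → ℝ → ℝ)
    (hR : ∀ θ : Stage5Params F N, θ.Admissible → D = datumOfRecord₅ F N θ → ∀ P : B12.RunParams, ROpLeaf (θ.res.V P))
    (hcor : ∀ θ : Stage5Params F N, θ.Admissible → D = datumOfRecord₅ F N θ →
      ∃ R : B14Cor3.ReprFamily (datumOfRecord₅ F N θ).C,
        B14Cor3.LeafH (datumOfRecord₅ F N θ).C R w.γ ∧ B14Cor3.LeafU1 (datumOfRecord₅ F N θ).C R w.γ ∧
        B14Cor3.LeafU2 (datumOfRecord₅ F N θ).C R w.γ (eP D) ∧ B14Cor3.LeafL1 (datumOfRecord₅ F N θ).C R w.γ ∧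
        B14Cor3.LeafL2 (datumOfRecord₅ F N θ).C R w.γ (eM D))
    (hlo : FlowStep.BetaLowerH w.b γ₀ D.βfun) (hhi : FlowStep.BetaUpperH w.βup γ₀ D.βfun) :
    B16.EndStatementBPrinted D.C :=
  N24_at_record₅C_knit₁₃ h hγ₀ (b6_main_of_isRecordOfRecord₅C_of_prop26 h26 h) h05 h06 h07 h08 h09 h10 h11 h12 eM eP hR hcor hlo hhi

end KnitC

end Literature.MathematicalPhysics.QuantumFieldTheory.Balaban1983to89.Node00

end
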